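import Summits.RiemannHypothesis.RiemannHypothesis.Theorems.HandoffLoadCeiling
import Summits.RiemannHypothesis.RiemannHypothesis.Theorems.HandoffDecompositionConsequences
import HarnessLib

/-!
# HANDOFF — the LOAD CRITERION: `RH ↔ (∀ q, r(q) ≤ 1) ↔ (r(q) ≤ 1 for infinitely many primes q)` (cell rh-explicit, TRACK «HANDOFF», seat theory-2)

HONEST FRAMING. Nothing here proves or approaches RH; no definitions. conj-1's sealed object is the LOAD of the window of the
consecutive primes `q < q⁺`, `r(q) = D_q((log q⁺)/2)/cap(q)` (`handoffLoad`, `HandoffSemilocalEnergy.lean`): the aggregate deficit of the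
`{p < q}`-form at the END of the window in units of the cap `(log q)/√q`. `HandoffLoadCeiling.lean` proved `RH ⟹ r(q) ≤ 1` for every `q`.
This file adds the converse IN THE LIMIT, by reducing to theory-1's norm-level criterion (`HandoffDecompositionConsequences.lean`,
`riemannHypothesis_of_frequently_normBound`: `N(q)` for infinitely many primes ⟹ RH, because on the old cone the old form IS Weil's form and
`cap(q) → 0`): `r(q) ≤ 1` IS `N(q)` read through the aggregate deficit (`handoffNormBound_of_handoffLoad_le_one`; every test function's
deficit is at most `D_q·‖g‖₂²`, `deficit_le_aggregateDeficit_mul`). Hence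

* `riemannHypothesis_iff_forall_handoffLoad_le_one`: **`RH ↔ ∀ q prime, r(q) ≤ 1`**;
* `riemannHypothesis_of_frequently_handoffLoad_le_one`: **`r(q) ≤ 1` for INFINITELY MANY primes ⟹ RH**;
* `eventually_one_lt_handoffLoad_of_not_riemannHypothesis`: **`¬RH ⟹ r(q) > 1` for ALL primes from some point on** — under `¬RH` the old
  forms' deficits eventually EXCEED the cap at every window end (ineffective threshold: Yoshida's break point).

So the measured loads `r = 0.88 / 0.97 / 0.88` (q = 2, 3, 5; DERIVED, pre-directive), `0.966 / 0.760 / 0.897` (q = 7, 11, 13; two-lineage float,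
blind) and conj-1's 58 blind rows at `127 ≤ q ≤ 251` (all `< 1`) are instances of an RH-EQUIVALENT family read at finitely many `q` — consistent with
RH, deciding nothing (finitely many instances never do; `r ≤ 1` at fixed `q` is NECESSARY only, HANDOFF-STATEMENT §D.2–§D.3).

References: E. Bombieri, Rend. Mat. Acc. Lincei (9) 11 (2000) Thm 2 p. 193, §4 (`Bombieri2000Weil`); H. Yoshida, Adv. Stud. Pure Math. 21 (1992)
Prop. 6 p. 320 (`Yoshida1992HermitianForms`).
-/

set_option linter.dupNamespace false  -- the mandated namespace repeats `RiemannHypothesis`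

noncomputable section

open Set Filter Complex MeasureTheory Literature.NumberTheory.LFunctions
open Summit.RiemannHypothesis.RiemannHypothesis.Theorems.Handoff (deficit contribution ConsecutivePrimes)
open Summit.RiemannHypothesis.RiemannHypothesis.Theorems.HandoffDecomposition
open Summit.RiemannHypothesis.RiemannHypothesis.Theorems.HandoffSemilocalEnergy
open Summit.RiemannHypothesis.RiemannHypothesis.Theorems.HandoffLoadCeiling
open scoped Real ComplexConjugate

namespace Summit.RiemannHypothesis.RiemannHypothesis.Theorems.HandoffLoadCriterion

variable {g : ℝ → ℂ} {q : ℕ}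

/-- `cap(q) = handoffCap q` (theory-1's name) — the two spellings agree. [folklore] -/
theorem handoffCap_eq (q : ℕ) : handoffCap q = Real.log q / Real.sqrt q := rfl

/-- **`r(q) ≤ 1 ⟹ N(q)`**: if the load of the window of `q < q⁺` is at most `1`, i.e. `D_q((log q⁺)/2) ≤ cap(q)`, then every Weil test
function on the window end has `deficit_q(g) ≤ cap(q)‖g‖₂²` (theory-1's `HandoffNormBound q`). [folklore] -/
theorem handoffNormBound_of_handoffLoad_le_one (hq : q.Prime) (h : handoffLoad q (nextPrime q) ≤ 1) :
    HandoffNormBound q := by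
  intro g hg hsupp
  have hcap : 0 < Real.log q / Real.sqrt q := cap_pos hq.two_le
  have hD : aggregateDeficit q (Real.log (nextPrime q) / 2) ≤ Real.log q / Real.sqrt q := by
    have := (div_le_one hcap).1 h
    simpa [handoffLoad] using this
  have hN : 0 ≤ ∫ t, ‖g t‖ ^ 2 := integral_nonneg fun _ ↦ by positivity
  calc deficit q g ≤ aggregateDeficit q (Real.log (nextPrime q) / 2) * ∫ t, ‖g t‖ ^ 2 :=
        deficit_le_aggregateDeficit_mul hg hsupp
    _ ≤ Real.log q / Real.sqrt q * ∫ t, ‖g t‖ ^ 2 := mul_le_mul_of_nonneg_right hD hN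
    _ = handoffCap q * weilNorm2Sq g := by rw [handoffCap_eq, weilNorm2Sq]

/-- Conversely **`N(q) ⟹ r(q) ≤ 1`**: the norm-level condition at the window end bounds the aggregate deficit there by the cap
(the energy is an infimum over a NONEMPTY sphere). So `N(q) ↔ r(q) ≤ 1` for every prime `q`. [folklore] -/
theorem handoffLoad_le_one_of_handoffNormBound (hq : q.Prime) (h : HandoffNormBound q) :
    handoffLoad q (nextPrime q) ≤ 1 := by
  have hcap : 0 < Real.log q / Real.sqrt q := cap_pos hq.two_le
  have hb0 : 0 < Real.log (nextPrime q) / 2 := (consecutivePrimes_nextPrime hq).log_half_pos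
  rw [handoffLoad, div_le_one hcap, aggregateDeficit, neg_le]
  refine le_semilocalGroundEnergy (semilocalSphereValues_top_nonempty _ hb0) fun g hg hs _ hn ↦ ?_
  have hd := h g hg hs
  rw [handoffCap_eq, weilNorm2Sq, hn, mul_one] at hd
  unfold deficit at hd
  linarith

/-- **`N(q) ↔ r(q) ≤ 1`** (per prime). [folklore] -/
theorem handoffNormBound_iff_handoffLoad_le_one (hq : q.Prime) :
    HandoffNormBound q ↔ handoffLoad q (nextPrime q) ≤ 1 :=
  ⟨handoffLoad_le_one_of_handoffNormBound hq, handoffNormBound_of_handoffLoad_le_one hq⟩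

/-- **`r(q) ≤ 1` for infinitely many primes `q` ⟹ RH** (through `riemannHypothesis_of_frequently_normBound`: on the old cone the old form
IS Weil's form, so `N(q)` is `Re Q ≥ −cap(q)‖g‖₂²` there, and `cap(q) → 0` while the windows exhaust every cone). [cite: Bombieri2000Weil, Thm. 2 (criterion); §4] -/
theorem riemannHypothesis_of_frequently_handoffLoad_le_one
    (h : ∀ N : ℕ, ∃ q : ℕ, N ≤ q ∧ q.Prime ∧ handoffLoad q (nextPrime q) ≤ 1) : Summit.RiemannHypothesis := by
  refine riemannHypothesis_of_frequently_normBound fun N ↦ ?_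
  obtain ⟨q, hNq, hq, hr⟩ := h N
  exact ⟨q, hNq, hq, handoffNormBound_of_handoffLoad_le_one hq hr⟩

/-- **THE LOAD CRITERION: `RH ↔ ∀ q prime, r(q) ≤ 1`.** (`→`: `HandoffLoadCeiling.forall_handoffLoad_le_one_of_riemannHypothesis`; `←`: the
previous theorem along all primes.) [cite: Bombieri2000Weil, Thm. 2; this track] -/
theorem riemannHypothesis_iff_forall_handoffLoad_le_one :
    Summit.RiemannHypothesis ↔ ∀ q : ℕ, q.Prime → handoffLoad q (nextPrime q) ≤ 1 := by
  constructor
  · intro hRH q hq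
    exact forall_handoffLoad_le_one_of_riemannHypothesis (Summit.RiemannHypothesis_iff.1 hRH) q _
      (consecutivePrimes_nextPrime hq)
  · intro h
    refine riemannHypothesis_of_frequently_handoffLoad_le_one fun N ↦ ?_
    obtain ⟨q, hNq, hq⟩ := Nat.exists_infinite_primes N
    exact ⟨q, hNq, hq, h q hq⟩

/-- **`¬RH ⟹` the loads EVENTUALLY EXCEED `1`**: there is `N` with `r(q) > 1` for every prime `q ≥ N` — under `¬RH` the `{p < q}`-forms'
aggregate deficits at the window ends eventually exceed the cap `(log q)/√q` (the threshold `N` is ineffective: it is governed by Yoshida's break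
point). Contrapositive of `riemannHypothesis_of_frequently_handoffLoad_le_one`. [cite: Yoshida1992HermitianForms, Prop. 6 (p. 320); this track] -/
theorem eventually_one_lt_handoffLoad_of_not_riemannHypothesis (hRH : ¬ Summit.RiemannHypothesis) :
    ∃ N : ℕ, ∀ q : ℕ, N ≤ q → q.Prime → 1 < handoffLoad q (nextPrime q) := by
  by_contra h
  push Not at h
  exact hRH (riemannHypothesis_of_frequently_handoffLoad_le_one fun N ↦ by
    obtain ⟨q, hNq, hq, hr⟩ := h N
    exact ⟨q, hNq, hq, hr⟩)

/-- Dictionary: `r(q) ≤ 1 ↔ D_q((log q⁺)/2) ≤ cap(q)` (`q ≥ 2`). [folklore] -/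
theorem handoffLoad_le_one_iff {q' : ℕ} (hq : 2 ≤ q) :
    handoffLoad q q' ≤ 1 ↔ aggregateDeficit q (Real.log q' / 2) ≤ Real.log q / Real.sqrt q := by
  rw [handoffLoad, div_le_one (cap_pos hq)]

end Summit.RiemannHypothesis.RiemannHypothesis.Theorems.HandoffLoadCriterion

end
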